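import Literature.MathematicalPhysics.QuantumFieldTheory.Balaban1983to89.B12LQLocalityBound267

/-!
# `Balaban1983to89.B12QtildeRemainder123` — [Balaban1985Averaging] Prop. 3 (122)–(123) p. 36 FOR [I]'S `Q̃` OF (2.4)
([Balaban1987RG1] p. 254: «all results of the paper [12] are valid for it»): the remainder `C̃_V(B′) = Q̃_V(B′) − LQ̃_V B′`
of the linearization is UNIFORMLY QUADRATICALLY SMALL

HONEST FRAMING (cell `lit-balaban`, verbatim): statement-level skeleton of published theorems with citation tags;
proofs where landed; nothing here is a claim about the Yang–Mills mass gap.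

CITATION HEADER.  T. Bałaban, *Renormalization group approach to lattice gauge field theories. I*, Commun. Math. Phys.
**109** (1987) 249–301 [Balaban1987RG1] (cell paper B12 = «[I]»; PDF held `paper:balaban1987-cmp109-rg-i-small-field`,
journal page = PDF page + 248): (0.10)–(0.12) pp. 253–254, (2.4) p. 266, p. 267; T. Bałaban, *Averaging operations for
lattice gauge theories*, Commun. Math. Phys. **98** (1985) 17–51 [Balaban1985Averaging] (= [12] of [I]; held
`paper:balaban1985-cmp98-averaging`), Proposition 3 with (121)–(123), (126) p. 36 [PDF 20].  Unit `lit-balaban-r09`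
gen 11 (reader/typer of CMP 109; TAKING line `HOME/STATUS.md` 2026-08-21T21:2xZ), SKELETON rows `B12.Def@267` (the
linearization `LQ̃`, `C̃`) and `B12.Eq2.4` (`Q̃`); [B7] row B7.Prop3 is a consumer by reference.

WHAT IS PRINTED (verbatim, re-read from the held texts).  [B7] p. 36: *«Let us define Q(V₀, A, c) = (1/i) log (V̄₁)_c,
(121) then Q(V₀, A, c) is an analytic function of A and from (120) it follows that its Taylor expansion begins with a
first-order polynomial. Let us denote it by L(Q(V₀)A)_c. Thus we have Q(V₀, A, c) = L(Q(V₀)A)_c + C(V₀, A, c). (122)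
C(V₀, A, c) is an analytic function of A whose Taylor's expansion begins with a second-order polynomial (a quadratic
form), and |C(V₀, A, c)| ≤ C₁L²|A|² ≤ C₁(Lα₁)². (123)»*; *«so we have for the whole linear term |(Q(V₀)A)_c| ≤ |A| +
O(1)L²α₀|A| ≤ (1 + O(1)L²α₀)α₁ (126)»*; *«Proposition 3. There exist constants C₁, c₃, c₃ ≤ c₂, such that for α₀, α₁
≤ c₃ the function Q(V₀, A) = (1/i) log V̄₁ is an analytic function of A satisfying the equalities and bounds
(122)–(124). The constant C₁ depends on d and c₃ depends on d and L.»*  [I] p. 254: *«all results of the paper [12]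
are valid for it»*; p. 267: *«LQ̃B′ + C̃(B′)»*, *«D̃(B) has an expansion beginning with quadratic terms»*.

THE TYPING.  For [I]'s `Q̃_V(B′)(c) = (1/i) log (M_c(V′V)M_c(V)⁻¹)` of (2.4) over the lineage's (0.10)–(0.12)
(`B12AverageCorridor267.Qtilde L 𝐔 V`, `𝒯 = B12ContourAverage253.Tavg`; `ℤᵈ` corner cubes, DIVERGENCE D-b12g20.1) and
its linear part `LQ̃_V = B12AverageCorridor267.LQ` (the `s`-derivative at `0`), at a bondwise-`U1`, `ε₀`-regular `V`
(`‖V(∂p) − 1‖ ≤ ε₀` for all plaquettes, `(dL)²ε₀ ≤ 1/200`):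
* § 1, DOMAIN VERSIONS of r09 g9's analyticity lemmas (`B12Average012Analytic`): `𝐔(q,x)`, the (0.12) loops and
  `log(M_c(U_t)M_c(V)⁻¹)` are analytic in `t` at ANY member `U_{t₀}` whose relative contour families lie in the (0.10)
  domain `‖· − 1‖ < 1/100`, whose loops satisfy `‖W_x − 1‖ < 1` and with `‖M_c(U_{t₀})M_c(V)⁻¹ − 1‖ < 1` — unitarity of
  `U_{t₀}` is NOT needed (`analyticAt_Tavg_of_small`, `analyticAt_loopW_of_small`, `analyticAt_mlog_avgM_mul_of_small`);
* § 2, **`s ↦ Q̃_V(sB′)(c)` IS ANALYTIC ON THE WHOLE DISC `|s|·β·dL ≤ 1/1200`** (`β = sup_b‖B′(b)‖`;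
  `analyticAt_Qtilde_smul`): the domain facts along the line are r09 g11's perturbation chain
  (`B12LQLocalityBound267.norm_rel_permT_sub_one_le`, `norm_loopW_sub_le`, `norm_avgM_mul_inv_sub_one_le`);
* § 3, **(122)–(123) FOR [I]'S `Q̃`**: `‖Q̃_V(B′)(c) − (LQ̃_V B′)(c)‖ ≤ 192000·(β·dL)²` for `β·dL ≤ 1/4800`
  (`norm_Qtilde_sub_LQ_le_of_global`) — Cauchy's integral formula for `g(s) = Q̃_V(sB′)(c)` on `|s| = R/2`,
  `R = 1/(1200βdL)`: `g(1) − g′(0) = (2πi)⁻¹∮ g(z)dz/(z²(z−1))` with `|g| ≤ 40|s|βdL` (`norm_Qtilde_smul_le`), `g(0) = 0`,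
  `g′(0) = (LQ̃_V B′)(c)` by definition (Mathlib `DiffContOnCl.circleIntegral_sub_inv_smul`,
  `DifferentiableOn.deriv_eq_smul_circleIntegral`); the corridor-local form `norm_Qtilde_sub_LQ_le` (sup over
  `b ⊂ B(c₋) ∪ B(c₊)` only, [B7] Prop. 4 / `Qtilde_congr`, `isQppLocal_LQ`); and the (126)-shape bound for the whole
  `Q̃`: `‖Q̃_V(B′)(c)‖ ≤ 40·β·dL` for `β·dL ≤ 1/1200` (`norm_Qtilde_le`).
DIVERGENCES FROM PRINT / HONEST SCOPE.  (a) Print's (123) has `C₁(d)L²|A|²` with `|A|` the sup norm and an unspecified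
`C₁(d)`; here the explicit `192000·d²L²β²` (no optimality claimed) under the explicit smallness `β·dL ≤ 1/4800` (print:
`α₁ ≤ c₃(d, L)`).  (b) The decomposition (122) is the tautology `Q̃ = LQ̃ + (Q̃ − LQ̃)`; the content typed is the bound
(123) and the analyticity of `Q̃` along complex lines through `0` on a quantitative disc (§ 2), not joint analyticity in
all the variables `A_b` on a polydisc (print's setting; the tree has it at `B′ = 0` only, `analyticAt_Qtilde`).  (c) `ℤᵈ`
corner cubes and the lineage's (0.10)–(0.12); (124)–(125) (the explicit linear form) are `B12AverageCorridor267` § 8–9.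

WHAT IS PROVED: theorems only (no definition, no `Prop`-fact, no sorry; axioms `propext`, `Classical.choice`,
`Quot.sound`).  v1.1 (same seat, APPEND-ONLY; v1.0 = p306225): § 4 — `analyticAt_Qtilde_family` (any analytic family
`B′_t` with a small member, any complex normed parameter space) and `analyticOnNhd_Qtilde_fields` (analyticity on the
quantitative ball `‖B′‖·dL ≤ 1/1200` of the field space on a finite bond set; radius explicit).
-/

noncomputable section

open NormedSpace Finset Metric

namespace Literature.MathematicalPhysics.QuantumFieldTheory.Balaban1983to89.B12QtildeRemainder123

open Literature.MathematicalPhysics.QuantumLattice (ZdEdge blockMap blockBase blockSites mem_blockSites_iff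
  plaquetteHolonomyZd)
open B7BlockGeometry (qppBonds)
open B7Prop1Explicit (U1 mem_U1)
open B12AverageCorridor267 (Ustr loopW loopW_def avgM expU val_expU pert pert_apply pert_zero Qtilde LQ
  isQppLocal_LQ Qtilde_congr)
open B12ContourAverage253 (rel fedUnit val_fedUnit fedAvg permT permT_one Tavg Tavg_eq omegaA omegaA_nonneg
  isBlockLocal_Tavg)
open B12Average012Analytic (analyticAt_units_inv analyticAt_permT analyticAt_rel_permT analyticAt_lineR
  analyticAt_Ustr analyticAt_pert)
open B12LQLocalityBound267 (norm_pert_smul_sub_le norm_rel_permT_sub_one_le norm_loopW_Tavg_sub_one_le_all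
  norm_loopW_sub_le norm_avgM_mul_inv_sub_one_le norm_Qtilde_smul_le norm_LQ_le_of_global)
open B13CorridorSeparation (b0Z b0Z_mem_qppBonds)
open FederbushMean (fedSol analyticAt_fedSol)
open MatrixLog (mlog analyticAt_mlog)

variable {d : ℕ}
variable {E : Type*} [NormedAddCommGroup E] [NormedSpace ℂ E]
variable {𝔸 : Type*} [NormedRing 𝔸] [NormedAlgebra ℂ 𝔸] [NormOneClass 𝔸] [CompleteSpace 𝔸] {L : ℕ}

/-! ## § 1  Analyticity of (0.11)/(0.12)/(2.4) in the configuration AWAY from the unitary base point: domain versions of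
`B12Average012Analytic` -/

section Domain

variable (U : E → ZdEdge d → 𝔸ˣ) {t₀ : E} (hU : ∀ b, AnalyticAt ℂ (fun t => ((U t b : 𝔸ˣ) : 𝔸)) t₀)
include hU

omit [NormOneClass 𝔸] in
/-- [cite: Balaban1987RG1, (0.11) p.253][cite: Balaban1987RG1, (0.10) p.253] **`𝐔(q,x)` IS ANALYTIC IN THE CONFIGURATION
WHEREVER THE RELATIVE CONTOUR FAMILY IS IN THE DOMAIN OF (0.10)** (`‖U(Γ^π_{q,x})U(Γ_{q,x})⁻¹ − 1‖ < 1/100` at the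
member `U_{t₀}`; no unitarity needed): the domain form of `B12Average012Analytic.analyticAt_Tavg` (Federbush's solution is
analytic on the open domain, `FederbushMean.analyticAt_fedSol`). -/
theorem analyticAt_Tavg_of_small (hL : 0 < L) (x : Fin d → ℤ)
    (hreg : ∀ π, ‖rel (fun π : Equiv.Perm (Fin d) => permT L (U t₀) π x) 1 π - 1‖ < 1 / 100) :
    AnalyticAt ℂ (fun t => ((Tavg L (U t) x : 𝔸ˣ) : 𝔸)) t₀ := by
  have e' : (fun t => ((Tavg L (U t) x : 𝔸ˣ) : 𝔸))
      = fun t => Ring.inverse (fedSol (rel (fun π : Equiv.Perm (Fin d) => permT L (U t) π x) 1))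
          * ((permT L (U t) 1 x : 𝔸ˣ) : 𝔸) := by
    funext t
    rw [Tavg_eq hL, Units.val_mul, ← permT_one hL, ← val_fedUnit, Ring.inverse_unit]
  rw [e']
  refine AnalyticAt.fun_mul ?_ (analyticAt_permT U hU 1 x)
  have hsol : AnalyticAt ℂ (fun t => fedSol (rel (fun π : Equiv.Perm (Fin d) => permT L (U t) π x) 1)) t₀ :=
    (analyticAt_fedSol hreg).fun_comp_of_eq (analyticAt_rel_permT U hU x) rfl
  have hinv := analyticAt_inverse (𝕜 := ℂ) (fedUnit (rel (fun π : Equiv.Perm (Fin d) => permT L (U t₀) π x) 1))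
  rw [val_fedUnit] at hinv
  exact hinv.fun_comp_of_eq hsol rfl

omit [NormOneClass 𝔸] in
/-- [cite: Balaban1987RG1, (0.12) p.254] the (0.12) loops `W_x = 𝐔(q,x)U([x,x′])𝐔(q′,x′)⁻¹U(c)⁻¹` are analytic in the
configuration wherever all relative contour families are in the domain of (0.10). -/
theorem analyticAt_loopW_of_small (hL : 0 < L) (c : ZdEdge d) (x : Fin d → ℤ)
    (hreg : ∀ (y : Fin d → ℤ) π, ‖rel (fun π : Equiv.Perm (Fin d) => permT L (U t₀) π y) 1 π - 1‖ < 1 / 100) :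
    AnalyticAt ℂ (fun t => ((loopW L (fun U : ZdEdge d → 𝔸ˣ => Tavg L U) (U t) c x : 𝔸ˣ) : 𝔸)) t₀ := by
  have e' : (fun t => ((loopW L (fun U : ZdEdge d → 𝔸ˣ => Tavg L U) (U t) c x : 𝔸ˣ) : 𝔸)) = fun t =>
      ((Tavg L (U t) x : 𝔸ˣ) : 𝔸) * ((B7Eq61Linearization.lineR (U t) x c.2 L : 𝔸ˣ) : 𝔸)
        * (((Tavg L (U t) (x + Pi.single c.2 (L : ℤ)))⁻¹ : 𝔸ˣ) : 𝔸) * (((Ustr L (U t) c)⁻¹ : 𝔸ˣ) : 𝔸) := by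
    funext t
    rw [loopW_def, Units.val_mul, Units.val_mul, Units.val_mul]
  rw [e']
  exact (((analyticAt_Tavg_of_small U hU hL x (hreg x)).fun_mul (analyticAt_lineR U hU x c.2 L)).fun_mul
    (analyticAt_units_inv (analyticAt_Tavg_of_small U hU hL _ (hreg _)))).fun_mul
    (analyticAt_units_inv (analyticAt_Ustr U hU c))

omit [NormOneClass 𝔸] in
/-- [cite: Balaban1987RG1, (0.12) p.254][cite: Balaban1987RG1, (2.4) p.266] **`log (M_c(U_t) M_c(V)⁻¹)` IS ANALYTIC
IN `t`** wherever the relative contour families of `U_{t₀}` are in the domain of (0.10), the (0.12) loops of `U_{t₀}`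
satisfy `‖W_x − 1‖ < 1` (the series logarithm), and `‖M_c(U_{t₀})M_c(V)⁻¹ − 1‖ < 1` (the outer logarithm of (2.4)). -/
theorem analyticAt_mlog_avgM_mul_of_small (hL : 0 < L) (c : ZdEdge d)
    (hreg : ∀ (y : Fin d → ℤ) π, ‖rel (fun π : Equiv.Perm (Fin d) => permT L (U t₀) π y) 1 π - 1‖ < 1 / 100)
    (hloop : ∀ x ∈ blockSites L c.1,
      ‖((loopW L (fun U : ZdEdge d → 𝔸ˣ => Tavg L U) (U t₀) c x : 𝔸ˣ) : 𝔸) - 1‖ < 1)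
    (Mi : 𝔸) (hΔ : ‖((avgM L (fun U : ZdEdge d → 𝔸ˣ => Tavg L U) (U t₀) c : 𝔸ˣ) : 𝔸) * Mi - 1‖ < 1) :
    AnalyticAt ℂ (fun t => mlog (((avgM L (fun U : ZdEdge d → 𝔸ˣ => Tavg L U) (U t) c : 𝔸ˣ) : 𝔸) * Mi)) t₀ := by
  have e' : (fun t => ((avgM L (fun U : ZdEdge d → 𝔸ˣ => Tavg L U) (U t) c : 𝔸ˣ) : 𝔸)) = fun t =>
      exp (∑ x ∈ blockSites L c.1, ((L : ℂ) ^ d)⁻¹ •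
        mlog ((loopW L (fun U : ZdEdge d → 𝔸ˣ => Tavg L U) (U t) c x : 𝔸ˣ) : 𝔸)) * ((Ustr L (U t) c : 𝔸ˣ) : 𝔸) := by
    funext t
    unfold avgM
    rw [Units.val_mul, val_expU]
  have hM : AnalyticAt ℂ (fun t => ((avgM L (fun U : ZdEdge d → 𝔸ˣ => Tavg L U) (U t) c : 𝔸ˣ) : 𝔸)) t₀ := by
    rw [e']
    refine AnalyticAt.fun_mul ?_ (analyticAt_Ustr U hU c)
    refine (exp_analytic _).fun_comp_of_eq ?_ rfl
    refine Finset.analyticAt_fun_sum _ fun x hx => ?_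
    have hm : AnalyticAt ℂ
        (fun t => mlog ((loopW L (fun U : ZdEdge d → 𝔸ˣ => Tavg L U) (U t) c x : 𝔸ˣ) : 𝔸)) t₀ :=
      (analyticAt_mlog (hloop x hx)).fun_comp_of_eq (analyticAt_loopW_of_small U hU hL c x hreg) rfl
    exact (analyticAt_const (v := (((L : ℂ) ^ d)⁻¹ : ℂ))).smul hm
  exact (analyticAt_mlog hΔ).fun_comp_of_eq (hM.fun_mul analyticAt_const) rfl

end Domain

/-! ## § 2  The line `s ↦ Q̃_V(sB′)(c)` is analytic on the WHOLE disc `|s|·β·dL < 1/1200` -/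

section Line

variable {V : ZdEdge d → 𝔸ˣ} {B : ZdEdge d → 𝔸} {β ε₀ : ℝ}

/-- [folklore] the size of the bond perturbation `e^{isB′}` along the line and of the derived `Θ`:
`ρ = e^{|s|β} − 1`, `(1+ρ)^{dL} − 1 = e^{|s|βdL} − 1 ≤ y/(1−y) < 1/600` for `y = |s|βdL ≤ 1/1200`. -/
private theorem line_theta (hV : ∀ b, V b ∈ U1 𝔸) (hB : ∀ b, ‖B b‖ ≤ β) (c : ZdEdge d) (s : ℂ)
    (hs : ‖s‖ * (β * ((d : ℝ) * L)) ≤ 1 / 1200) :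
    ∃ ρ Θ : ℝ, 0 ≤ ρ ∧ (1 + ρ) ^ (d * L) - 1 ≤ Θ ∧ Θ < 1 / 600 ∧ Θ ≤ 2 * (‖s‖ * (β * ((d : ℝ) * L))) ∧
      (∀ b, ‖((pert (s • B) V b : 𝔸ˣ) : 𝔸) - V b‖ ≤ ρ) ∧
      (∀ b, ‖(((pert (s • B) V b)⁻¹ : 𝔸ˣ) : 𝔸) - (((V b)⁻¹ : 𝔸ˣ) : 𝔸)‖ ≤ ρ) := by
  have hβ : 0 ≤ β := (norm_nonneg _).trans (hB c)
  set y : ℝ := ‖s‖ * (β * ((d : ℝ) * L)) with hy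
  have hy0 : 0 ≤ y := by positivity
  have hy1 : y < 1 := by linarith
  refine ⟨Real.exp (‖s‖ * β) - 1, y / (1 - y), sub_nonneg.2 (Real.one_le_exp (by positivity)), ?_, ?_, ?_,
    fun b => (norm_pert_smul_sub_le hV hB s b).1, fun b => (norm_pert_smul_sub_le hV hB s b).2⟩
  · have hpow : (1 + (Real.exp (‖s‖ * β) - 1)) ^ (d * L) - 1 = Real.exp y - 1 := by
      rw [add_sub_cancel, ← Real.exp_nat_mul,
        show ((d * L : ℕ) : ℝ) * (‖s‖ * β) = y by rw [hy]; push_cast; ring]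
    rw [hpow]
    have h := Real.exp_bound_div_one_sub_of_interval hy0 hy1
    have hne : 1 - y ≠ 0 := by linarith
    have : y / (1 - y) = 1 / (1 - y) - 1 := by field_simp; ring
    linarith
  · rw [div_lt_iff₀ (by linarith)]; linarith
  · rw [div_le_iff₀ (by linarith)]; nlinarith

/-- [cite: Balaban1987RG1, (2.4) p.266][cite: Balaban1985Averaging, Prop.3 (121) p.36] **`Q̃_V(sB′)(c)` IS ANALYTIC AT
EVERY `s` OF THE DISC `|s|·β·dL ≤ 1/1200`** (`β = sup_b‖B′(b)‖`; bondwise-`U1`, `ε₀`-regular `V`, `(dL)²ε₀ ≤ 1/200`) —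
not only at `s = 0` (`B12Average012Analytic.analyticAt_Qtilde`): along the line the relative contour families stay in
the (0.10) domain (`norm_rel_permT_sub_one_le`), the loops in `‖W − 1‖ ≤ 1/10`, and `‖M_c(V′V)M_c(V)⁻¹ − 1‖ ≤ 36Θ < 1`
(`norm_avgM_mul_inv_sub_one_le`), so § 1 applies; [B7] Prop. 3's «Q(V₀, A, c) … is an analytic function of A» on a
quantitative polydisc slice. -/
theorem analyticAt_Qtilde_smul (hL : 0 < L) (hd : 1 ≤ d) (hV : ∀ b, V b ∈ U1 𝔸) (hε₀ : 0 ≤ ε₀)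
    (hsm : ((d : ℝ) * L) ^ 2 * ε₀ ≤ 1 / 200)
    (h44 : ∀ (p : Fin d → ℤ) (i j : Fin d), i ≠ j → ‖((plaquetteHolonomyZd V p i j : 𝔸ˣ) : 𝔸) - 1‖ ≤ ε₀)
    (hB : ∀ b, ‖B b‖ ≤ β) (c : ZdEdge d) {s₀ : ℂ} (hs : ‖s₀‖ * (β * ((d : ℝ) * L)) ≤ 1 / 1200) :
    AnalyticAt ℂ (fun s : ℂ => Qtilde L (fun U : ZdEdge d → 𝔸ˣ => Tavg L U) V (s • B) c) s₀ := by
  obtain ⟨ρ, Θ, hρ, hρΘ, hΘs, -, h1, h2⟩ := line_theta hV hB c s₀ hs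
  have hU : ∀ b, AnalyticAt ℂ (fun s : ℂ => ((pert (s • B) V b : 𝔸ˣ) : 𝔸)) s₀ :=
    analyticAt_pert (fun s : ℂ => s • B) (fun b => (analyticAt_id).smul analyticAt_const) V
  -- the three domain facts at `V′ = e^{is₀B}V`
  have hreg : ∀ (y : Fin d → ℤ) π,
      ‖rel (fun π : Equiv.Perm (Fin d) => permT L (pert (s₀ • B) V) π y) 1 π - 1‖ < 1 / 100 := fun y π =>
    (norm_rel_permT_sub_one_le hL hV hρ hρΘ (by linarith) h1 h2 hε₀ hsm h44 y π).trans_lt (by linarith)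
  have hω : omegaA d L ε₀ ≤ 1 / 20 := by
    have : omegaA d L ε₀ = 10 * (((d : ℝ) * L) ^ 2 * ε₀) := by unfold omegaA; ring
    rw [this]; linarith
  have hloop : ∀ x ∈ blockSites L c.1,
      ‖((loopW L (fun U : ZdEdge d → 𝔸ˣ => Tavg L U) (pert (s₀ • B) V) c x : 𝔸ˣ) : 𝔸) - 1‖ < 1 := by
    intro x hx
    have hb := (norm_loopW_Tavg_sub_one_le_all hL hd hV hε₀ (hsm.trans (by norm_num)) h44 c x hx).trans hω
    have hdiff := norm_loopW_sub_le hL hd hV hρ hρΘ hΘs.le h1 h2 hε₀ hsm h44 c x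
    have := norm_sub_le_norm_sub_add_norm_sub
      ((loopW L (fun U : ZdEdge d → 𝔸ˣ => Tavg L U) (pert (s₀ • B) V) c x : 𝔸ˣ) : 𝔸)
      ((loopW L (fun U : ZdEdge d → 𝔸ˣ => Tavg L U) V c x : 𝔸ˣ) : 𝔸) 1
    linarith
  have hΔ : ‖((avgM L (fun U : ZdEdge d → 𝔸ˣ => Tavg L U) (pert (s₀ • B) V) c : 𝔸ˣ) : 𝔸)
      * (((avgM L (fun U : ZdEdge d → 𝔸ˣ => Tavg L U) V c)⁻¹ : 𝔸ˣ) : 𝔸) - 1‖ < 1 := by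
    have h := norm_avgM_mul_inv_sub_one_le hL hd hV hρ hρΘ hΘs.le h1 h2 hε₀ hsm h44 c
    rw [Units.val_mul] at h
    linarith
  have e' : (fun s : ℂ => Qtilde L (fun U : ZdEdge d → 𝔸ˣ => Tavg L U) V (s • B) c) = fun s =>
      (-Complex.I) • mlog (((avgM L (fun U : ZdEdge d → 𝔸ˣ => Tavg L U) (pert (s • B) V) c : 𝔸ˣ) : 𝔸)
        * (((avgM L (fun U : ZdEdge d → 𝔸ˣ => Tavg L U) V c)⁻¹ : 𝔸ˣ) : 𝔸)) := by
    funext s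
    unfold Qtilde
    rw [Units.val_mul]
  rw [e']
  exact (analyticAt_const (v := (-Complex.I : ℂ))).smul
    (analyticAt_mlog_avgM_mul_of_small (fun s : ℂ => pert (s • B) V) hU hL c hreg hloop _ hΔ)

/-! ## § 3  [B7] (122)–(123) for [I]'s `Q̃`: the second-order remainder by Cauchy's formula on `|s| = R/2` -/

/-- [cite: Balaban1985Averaging, (122)-(123) p.36][cite: Balaban1987RG1, (2.4) p.266][cite: Balaban1987RG1, p.267] **THE
REMAINDER OF THE LINEARIZATION OF [I]'S `Q̃` IS UNIFORMLY QUADRATICALLY SMALL** ([B7] Prop. 3: «Q(V₀, A, c) =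
L(Q(V₀)A)_c + C(V₀, A, c), (122) C(V₀, A, c) is an analytic function of A whose Taylor's expansion begins with a
second-order polynomial (a quadratic form), and |C(V₀, A, c)| ≤ C₁L²|A|² ≤ C₁(Lα₁)². (123)»; [I] p. 254 «all results
of the paper [12] are valid for it», p. 267 «LQ̃B′ + C̃(B′)»): at a bondwise-`U1`, `ε₀`-regular `V` with
`(dL)²ε₀ ≤ 1/200`, for `‖B′(b)‖ ≤ β` with `β·dL ≤ 1/4800`,
**`‖Q̃_V(B′)(c) − (LQ̃_V B′)(c)‖ ≤ 192000·(β·dL)²`** — Cauchy's integral formula for `g(s) = Q̃_V(sB′)(c)` on the circle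
`|s| = R/2`, `R = 1/(1200βdL)` (`g` analytic on the disc by `analyticAt_Qtilde_smul`, `|g(s)| ≤ 40|s|βdL` by
`norm_Qtilde_smul_le`, `g(0) = 0`, `g′(0) = (LQ̃_V B′)(c)` by definition):
`g(1) − g′(0) = (2πi)⁻¹∮ g(z) dz/(z²(z−1))`.  DIVERGENCE: print's constant is `C₁(d)L²`; here `192000·d²L²`
(sup-norm, no optimality claimed). -/
theorem norm_Qtilde_sub_LQ_le_of_global (hL : 0 < L) (hd : 1 ≤ d) (V : ZdEdge d → 𝔸ˣ) (hV : ∀ b, V b ∈ U1 𝔸)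
    (hε₀ : 0 ≤ ε₀) (hsm : ((d : ℝ) * L) ^ 2 * ε₀ ≤ 1 / 200)
    (h44 : ∀ (p : Fin d → ℤ) (i j : Fin d), i ≠ j → ‖((plaquetteHolonomyZd V p i j : 𝔸ˣ) : 𝔸) - 1‖ ≤ ε₀)
    (hB : ∀ b, ‖B b‖ ≤ β) (hβ : β * ((d : ℝ) * L) ≤ 1 / 4800) (c : ZdEdge d) :
    ‖Qtilde L (fun U : ZdEdge d → 𝔸ˣ => Tavg L U) V B c - LQ L (fun U : ZdEdge d → 𝔸ˣ => Tavg L U) V B c‖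
      ≤ 192000 * (β * ((d : ℝ) * L)) ^ 2 := by
  have hβ0 : 0 ≤ β := (norm_nonneg _).trans (hB c)
  set g : ℂ → 𝔸 := fun s => Qtilde L (fun U : ZdEdge d → 𝔸ˣ => Tavg L U) V (s • B) c with hg
  have hg1 : g 1 = Qtilde L (fun U : ZdEdge d → 𝔸ˣ => Tavg L U) V B c := by rw [hg]; simp only [one_smul]
  have hg0 : g 0 = 0 := by
    rw [hg]; simp only [zero_smul]
    unfold Qtilde; rw [pert_zero, mul_inv_cancel, Units.val_one, MatrixLog.mlog_one, smul_zero]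
  have hgd : deriv g 0 = LQ L (fun U : ZdEdge d → 𝔸ˣ => Tavg L U) V B c := rfl
  rcases hβ0.eq_or_lt with hβz | hβpos
  · -- `β = 0`: `B′ = 0`, both sides vanish
    have hB0 : B = 0 := funext fun b => norm_le_zero_iff.1 (by rw [← hβz] at hB; exact (hB b).trans le_rfl)
    have hQ : ∀ s : ℂ, g s = 0 := fun s => by
      rw [hg]; simp only [hB0, smul_zero]
      unfold Qtilde; rw [pert_zero, mul_inv_cancel, Units.val_one, MatrixLog.mlog_one, smul_zero]
    have hd0 : deriv g 0 = 0 := by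
      rw [show g = fun _ => (0 : 𝔸) from funext hQ]; exact deriv_const 0 0
    rw [← hg1, ← hgd, hQ 1, hd0, sub_zero, norm_zero]; positivity
  -- `β > 0`: Cauchy on the circle of radius `ρ = R/2`
  have hdL : (1 : ℝ) ≤ (d : ℝ) * L := by
    have : (1 : ℝ) ≤ d := by exact_mod_cast hd
    have : (1 : ℝ) ≤ L := by exact_mod_cast hL
    nlinarith
  set x : ℝ := β * ((d : ℝ) * L) with hx
  have hx0 : 0 < x := by positivity
  set ρ : ℝ := 1 / (2400 * x) with hρdef
  have hρ0 : 0 < ρ := by positivity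
  have hρ2 : 2 ≤ ρ := by
    rw [hρdef, le_div_iff₀ (by positivity)]; nlinarith
  have hρx : ρ * x = 1 / 2400 := by rw [hρdef]; field_simp
  -- analyticity on the closed disc of radius `ρ`
  have han : ∀ z ∈ closedBall (0 : ℂ) ρ, AnalyticAt ℂ g z := fun z hz => by
    refine analyticAt_Qtilde_smul hL hd hV hε₀ hsm h44 hB c ?_
    rw [mem_closedBall, dist_zero_right] at hz
    calc ‖z‖ * (β * ((d : ℝ) * L)) ≤ ρ * x := mul_le_mul_of_nonneg_right hz hx0.le
      _ ≤ 1 / 1200 := by rw [hρx]; norm_num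
  have hdiff : DifferentiableOn ℂ g (closedBall (0 : ℂ) ρ) := fun z hz =>
    (han z hz).differentiableAt.differentiableWithinAt
  have hdc : DiffContOnCl ℂ g (ball (0 : ℂ) ρ) := (hdiff.mono closure_ball_subset_closedBall).diffContOnCl
  have hcont : ContinuousOn g (sphere (0 : ℂ) ρ) := hdiff.continuousOn.mono sphere_subset_closedBall
  -- the bound on the circle
  have hM : ∀ z ∈ sphere (0 : ℂ) ρ, ‖g z‖ ≤ 40 * (ρ * x) := fun z hz => by
    rw [mem_sphere_zero_iff_norm] at hz
    have h := norm_Qtilde_smul_le hL hd hV hε₀ hsm h44 hB c (s := z) (by rw [hz, hρx]; norm_num)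
    rw [hz] at h; exact h
  -- Cauchy's formulas
  have h1ball : (1 : ℂ) ∈ ball (0 : ℂ) ρ := by
    rw [mem_ball, dist_zero_right, norm_one]; linarith
  have h0ball : (0 : ℂ) ∈ ball (0 : ℂ) ρ := mem_ball_self hρ0
  have hc1 := hdc.circleIntegral_sub_inv_smul h1ball
  have hc0 := hdc.circleIntegral_sub_inv_smul h0ball
  have hcd := hdiff.deriv_eq_smul_circleIntegral hρ0
  rw [hg0, smul_zero] at hc0
  -- sphere facts
  have hsph : ∀ z ∈ sphere (0 : ℂ) ρ, ‖z‖ = ρ ∧ z ≠ 0 ∧ z ≠ 1 ∧ ρ - 1 ≤ ‖z - 1‖ := fun z hz => by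
    rw [mem_sphere_zero_iff_norm] at hz
    refine ⟨hz, ?_, ?_, ?_⟩
    · intro h; rw [h, norm_zero] at hz; linarith
    · intro h; rw [h, norm_one] at hz; linarith
    · have := norm_sub_norm_le z 1; rw [hz, norm_one] at this; exact this
  -- integrability of the three Cauchy kernels against `g`
  have hint : ∀ w : ℂ, (∀ z ∈ sphere (0 : ℂ) ρ, z ≠ w) →
      CircleIntegrable (fun z => (z - w)⁻¹ • g z) 0 ρ := fun w hw =>
    (((continuousOn_id.sub continuousOn_const).inv₀ fun z hz => sub_ne_zero.2 (hw z hz)).smul hcont).circleIntegrable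
      hρ0.le
  have hint1 := hint 1 fun z hz => (hsph z hz).2.2.1
  have hint0 := hint 0 fun z hz => (hsph z hz).2.1
  have hint2 : CircleIntegrable (fun z => (1 / (z - 0) ^ 2) • g z) 0 ρ :=
    (((continuousOn_const).div ((continuousOn_id.sub continuousOn_const).pow 2) fun z hz =>
      pow_ne_zero 2 (sub_ne_zero.2 (hsph z hz).2.1)).smul hcont).circleIntegrable hρ0.le
  -- the combined kernel
  have hint10 : CircleIntegrable (fun z => (z - 1)⁻¹ • g z - (z - 0)⁻¹ • g z) 0 ρ := hint1.sub hint0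
  have hcomb : (∮ z in C(0, ρ), ((z - 1)⁻¹ • g z - (z - 0)⁻¹ • g z - (1 / (z - 0) ^ 2) • g z))
      = (2 * Real.pi * Complex.I : ℂ) • (g 1 - deriv g 0) := by
    have e1 := circleIntegral.integral_sub hint10 hint2
    have e2 := circleIntegral.integral_sub hint1 hint0
    rw [e1, e2, hc1, hc0, hcd, sub_zero, smul_sub]
  have hρ1 : 0 < ρ - 1 := by linarith
  have hρ1' : ρ - 1 ≠ 0 := hρ1.ne'
  have hker : ∀ z ∈ sphere (0 : ℂ) ρ,
      ‖(z - 1)⁻¹ • g z - (z - 0)⁻¹ • g z - (1 / (z - 0) ^ 2) • g z‖ ≤ 1 / (ρ ^ 2 * (ρ - 1)) * (40 * (ρ * x)) := by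
    intro z hz
    obtain ⟨hzn, hz0, hz1, hz1'⟩ := hsph z hz
    have hid : (z - 1)⁻¹ • g z - (z - 0)⁻¹ • g z - (1 / (z - 0) ^ 2) • g z = (1 / (z ^ 2 * (z - 1))) • g z := by
      rw [← sub_smul, ← sub_smul]
      congr 1
      have hz1'' : z - 1 ≠ 0 := sub_ne_zero.2 hz1
      field_simp
      ring
    rw [hid, norm_smul]
    refine mul_le_mul ?_ (hM z hz) (norm_nonneg _) (div_nonneg zero_le_one (mul_nonneg (pow_nonneg hρ0.le 2) hρ1.le))
    rw [norm_div, norm_one, norm_mul, norm_pow, hzn]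
    exact one_div_le_one_div_of_le (by nlinarith) (mul_le_mul_of_nonneg_left hz1' (by positivity))
  have hnorm := circleIntegral.norm_two_pi_i_inv_smul_integral_le_of_norm_le_const hρ0.le hker
  rw [hcomb, inv_smul_smul₀ Complex.two_pi_I_ne_zero] at hnorm
  rw [← hg1, ← hgd]
  refine hnorm.trans ?_
  -- `ρ · (1/(ρ²(ρ−1))) · 40ρx = 40x/(ρ−1) ≤ 80x/ρ = 192000 x²`
  rw [show ρ * (1 / (ρ ^ 2 * (ρ - 1)) * (40 * (ρ * x))) = 40 * x / (ρ - 1) by field_simp]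
  rw [div_le_iff₀ hρ1]
  have : 192000 * x ^ 2 * (ρ - 1) = 80 * x * (2400 * x * ρ) - 192000 * x ^ 2 := by ring
  rw [this, show 2400 * x * ρ = 1 by rw [hρdef]; field_simp]
  nlinarith

/-- [cite: Balaban1985Averaging, (122)-(123) p.36][cite: Balaban1985Averaging, (140) p.39][cite: Balaban1987RG1, p.267]
**THE SAME WITH THE SUP OVER THE CORRIDOR BONDS ONLY** (`Q̃_V(·)(c)` and `LQ̃_V(·)(c)` depend on `B′` only through
`b ⊂ B(c₋) ∪ B(c₊)`, [B7] Prop. 4 / `Qtilde_congr`, `isQppLocal_LQ`): `‖B′(b)‖ ≤ M` there and `M·dL ≤ 1/4800` give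
`‖Q̃_V(B′)(c) − (LQ̃_V B′)(c)‖ ≤ 192000·(M·dL)²`. -/
theorem norm_Qtilde_sub_LQ_le (hL : 0 < L) (hd : 1 ≤ d) (V : ZdEdge d → 𝔸ˣ) (hV : ∀ b, V b ∈ U1 𝔸)
    (hε₀ : 0 ≤ ε₀) (hsm : ((d : ℝ) * L) ^ 2 * ε₀ ≤ 1 / 200)
    (h44 : ∀ (p : Fin d → ℤ) (i j : Fin d), i ≠ j → ‖((plaquetteHolonomyZd V p i j : 𝔸ˣ) : 𝔸) - 1‖ ≤ ε₀)
    (c : ZdEdge d) {B : ZdEdge d → 𝔸} {M : ℝ} (hM : ∀ b ∈ qppBonds L c, ‖B b‖ ≤ M)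
    (hMs : M * ((d : ℝ) * L) ≤ 1 / 4800) :
    ‖Qtilde L (fun U : ZdEdge d → 𝔸ˣ => Tavg L U) V B c - LQ L (fun U : ZdEdge d → 𝔸ˣ => Tavg L U) V B c‖
      ≤ 192000 * (M * ((d : ℝ) * L)) ^ 2 := by
  classical
  have hM0 : 0 ≤ M := (norm_nonneg _).trans (hM _ (b0Z_mem_qppBonds hL c))
  set B' : ZdEdge d → 𝔸 := fun b => if b ∈ qppBonds L c then B b else 0 with hB'def
  have hB' : ∀ b, ‖B' b‖ ≤ M := fun b => by
    by_cases hb : b ∈ qppBonds L c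
    · simp only [hB'def, if_pos hb]; exact hM b hb
    · simp only [hB'def, if_neg hb, norm_zero]; exact hM0
  have hagree : ∀ b ∈ qppBonds L c, B b = B' b := fun b hb => by simp only [hB'def, if_pos hb]
  rw [Qtilde_congr hL (isBlockLocal_Tavg hL) V hagree, isQppLocal_LQ hL (isBlockLocal_Tavg hL) V B B' c hagree]
  exact norm_Qtilde_sub_LQ_le_of_global hL hd V hV hε₀ hsm h44 hB' hMs c

/-- [cite: Balaban1985Averaging, (126) p.36][cite: Balaban1987RG1, (2.4) p.266] **THE WHOLE `Q̃_V(B′)(c)` IS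
`O(|B′|)`** ([B7] (126)-shape «|(Q(V₀)A)_c| ≤ … ≤ (1 + O(1)L²α₀)α₁» for the full nonlinear `Q̃`): `‖Q̃_V(B′)(c)‖ ≤ 40·β·dL`
for `‖B′(b)‖ ≤ β`, `β·dL ≤ 1/1200` (`norm_Qtilde_smul_le` at `s = 1`). -/
theorem norm_Qtilde_le (hL : 0 < L) (hd : 1 ≤ d) (V : ZdEdge d → 𝔸ˣ) (hV : ∀ b, V b ∈ U1 𝔸) (hε₀ : 0 ≤ ε₀)
    (hsm : ((d : ℝ) * L) ^ 2 * ε₀ ≤ 1 / 200)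
    (h44 : ∀ (p : Fin d → ℤ) (i j : Fin d), i ≠ j → ‖((plaquetteHolonomyZd V p i j : 𝔸ˣ) : 𝔸) - 1‖ ≤ ε₀)
    (hB : ∀ b, ‖B b‖ ≤ β) (hβ : β * ((d : ℝ) * L) ≤ 1 / 1200) (c : ZdEdge d) :
    ‖Qtilde L (fun U : ZdEdge d → 𝔸ˣ => Tavg L U) V B c‖ ≤ 40 * (β * ((d : ℝ) * L)) := by
  have h := norm_Qtilde_smul_le hL hd hV hε₀ hsm h44 hB c (s := (1 : ℂ)) (by rw [norm_one, one_mul]; exact hβ)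
  rwa [one_smul, norm_one, one_mul] at h

end Line

/-! ## § 4 (v1.1)  General analytic families and the QUANTITATIVE BALL of analyticity on the field space -/

section Family

variable {V : ZdEdge d → 𝔸ˣ} {β ε₀ : ℝ}

/-- [cite: Balaban1987RG1, (2.4) p.266][cite: Balaban1985Averaging, Prop.3 (121) p.36] **`Q̃_V(B′_t)(c)` IS ANALYTIC
AT `t₀` FOR EVERY ANALYTIC FAMILY `t ↦ B′_t` WITH `sup_b‖B′_{t₀}(b)‖·dL ≤ 1/1200`** (any complex normed parameter
space; bondwise-`U1`, `ε₀`-regular `V`, `(dL)²ε₀ ≤ 1/200`) — the tree's `B12Average012Analytic.analyticAt_Qtilde`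
required `B′_{t₀} = 0`; here the member only has to be small (domain facts of `B12LQLocalityBound267` at
`V′ = e^{iB′_{t₀}}V`, § 1). -/
theorem analyticAt_Qtilde_family (hL : 0 < L) (hd : 1 ≤ d) (hV : ∀ b, V b ∈ U1 𝔸) (hε₀ : 0 ≤ ε₀)
    (hsm : ((d : ℝ) * L) ^ 2 * ε₀ ≤ 1 / 200)
    (h44 : ∀ (p : Fin d → ℤ) (i j : Fin d), i ≠ j → ‖((plaquetteHolonomyZd V p i j : 𝔸ˣ) : 𝔸) - 1‖ ≤ ε₀)
    (B : E → ZdEdge d → 𝔸) {t₀ : E} (hB : ∀ b, AnalyticAt ℂ (fun t => B t b) t₀) (hβ : ∀ b, ‖B t₀ b‖ ≤ β)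
    (hβs : β * ((d : ℝ) * L) ≤ 1 / 1200) (c : ZdEdge d) :
    AnalyticAt ℂ (fun t => Qtilde L (fun U : ZdEdge d → 𝔸ˣ => Tavg L U) V (B t) c) t₀ := by
  obtain ⟨ρ, Θ, hρ, hρΘ, hΘs, -, h1, h2⟩ :=
    line_theta hV hβ c (1 : ℂ) (by rw [norm_one, one_mul]; exact hβs)
  simp only [one_smul] at h1 h2
  have hU : ∀ b, AnalyticAt ℂ (fun t => ((pert (B t) V b : 𝔸ˣ) : 𝔸)) t₀ := analyticAt_pert B hB V
  have hreg : ∀ (y : Fin d → ℤ) π,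
      ‖rel (fun π : Equiv.Perm (Fin d) => permT L (pert (B t₀) V) π y) 1 π - 1‖ < 1 / 100 := fun y π =>
    (norm_rel_permT_sub_one_le hL hV hρ hρΘ (by linarith) h1 h2 hε₀ hsm h44 y π).trans_lt (by linarith)
  have hω : omegaA d L ε₀ ≤ 1 / 20 := by
    have : omegaA d L ε₀ = 10 * (((d : ℝ) * L) ^ 2 * ε₀) := by unfold omegaA; ring
    rw [this]; linarith
  have hloop : ∀ x ∈ blockSites L c.1,
      ‖((loopW L (fun U : ZdEdge d → 𝔸ˣ => Tavg L U) (pert (B t₀) V) c x : 𝔸ˣ) : 𝔸) - 1‖ < 1 := by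
    intro x hx
    have hb := (norm_loopW_Tavg_sub_one_le_all hL hd hV hε₀ (hsm.trans (by norm_num)) h44 c x hx).trans hω
    have hdiff := norm_loopW_sub_le hL hd hV hρ hρΘ hΘs.le h1 h2 hε₀ hsm h44 c x
    have := norm_sub_le_norm_sub_add_norm_sub
      ((loopW L (fun U : ZdEdge d → 𝔸ˣ => Tavg L U) (pert (B t₀) V) c x : 𝔸ˣ) : 𝔸)
      ((loopW L (fun U : ZdEdge d → 𝔸ˣ => Tavg L U) V c x : 𝔸ˣ) : 𝔸) 1
    linarith
  have hΔ : ‖((avgM L (fun U : ZdEdge d → 𝔸ˣ => Tavg L U) (pert (B t₀) V) c : 𝔸ˣ) : 𝔸)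
      * (((avgM L (fun U : ZdEdge d → 𝔸ˣ => Tavg L U) V c)⁻¹ : 𝔸ˣ) : 𝔸) - 1‖ < 1 := by
    have h := norm_avgM_mul_inv_sub_one_le hL hd hV hρ hρΘ hΘs.le h1 h2 hε₀ hsm h44 c
    rw [Units.val_mul] at h
    linarith
  have e' : (fun t => Qtilde L (fun U : ZdEdge d → 𝔸ˣ => Tavg L U) V (B t) c) = fun t =>
      (-Complex.I) • mlog (((avgM L (fun U : ZdEdge d → 𝔸ˣ => Tavg L U) (pert (B t) V) c : 𝔸ˣ) : 𝔸)
        * (((avgM L (fun U : ZdEdge d → 𝔸ˣ => Tavg L U) V c)⁻¹ : 𝔸ˣ) : 𝔸)) := by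
    funext t
    unfold Qtilde
    rw [Units.val_mul]
  rw [e']
  exact (analyticAt_const (v := (-Complex.I : ℂ))).smul
    (analyticAt_mlog_avgM_mul_of_small (fun t => pert (B t) V) hU hL c hreg hloop _ hΔ)

/-- [cite: Balaban1985Averaging, Prop.3 p.36][cite: Balaban1987RG1, (2.4) p.266] **`Q̃_V(·)(c)` IS COMPLEX-ANALYTIC
ON THE WHOLE BALL `‖B′‖·dL ≤ 1/1200` OF THE BANACH SPACE OF FIELDS ON ANY FINITE BOND SET `S`** (extended by `0`;
sup norm) — [B7] Prop. 3's «for α₀, α₁ ≤ c₃ the function Q(V₀, A) … is an analytic function of A», `|A| < α₁`, with an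
explicit radius (the tree's `B12Average012AnalyticIter.analyticAt_Qtilde_fields`: the germ at `0`, radius not
estimated). -/
theorem analyticOnNhd_Qtilde_fields (hL : 0 < L) (hd : 1 ≤ d) (V : ZdEdge d → 𝔸ˣ) (hV : ∀ b, V b ∈ U1 𝔸)
    (hε₀ : 0 ≤ ε₀) (hsm : ((d : ℝ) * L) ^ 2 * ε₀ ≤ 1 / 200)
    (h44 : ∀ (p : Fin d → ℤ) (i j : Fin d), i ≠ j → ‖((plaquetteHolonomyZd V p i j : 𝔸ˣ) : 𝔸) - 1‖ ≤ ε₀)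
    (S : Finset (ZdEdge d)) (c : ZdEdge d) :
    AnalyticOnNhd ℂ (fun B : (S → 𝔸) =>
      Qtilde L (fun U : ZdEdge d → 𝔸ˣ => Tavg L U) V (fun b => if h : b ∈ S then B ⟨b, h⟩ else 0) c)
      {B : (S → 𝔸) | ‖B‖ * ((d : ℝ) * L) ≤ 1 / 1200} := by
  intro B₀ hB₀
  refine analyticAt_Qtilde_family (E := S → 𝔸) hL hd hV hε₀ hsm h44
    (fun (B : S → 𝔸) b => if h : b ∈ S then B ⟨b, h⟩ else 0) (fun b => ?_) (fun b => ?_) hB₀ c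
  · by_cases h : b ∈ S
    · simp only [dif_pos h]
      exact (ContinuousLinearMap.proj (R := ℂ) (φ := fun _ : S => 𝔸) (⟨b, h⟩ : S)).analyticAt B₀
    · simp only [dif_neg h]
      exact analyticAt_const
  · by_cases h : b ∈ S
    · simp only [dif_pos h]; exact norm_le_pi_norm B₀ ⟨b, h⟩
    · simp only [dif_neg h, norm_zero]; exact norm_nonneg _

end Family

end Literature.MathematicalPhysics.QuantumFieldTheory.Balaban1983to89.B12QtildeRemainder123

end
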